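import Literature.ModelTheory.Zilber.EACDensityNonFree
import Literature.ModelTheory.Zilber.EACDensityAligned
import HarnessLib

/-!
# Multiplicatively dependent surfaces over a graph base: a complete decision

A pub-cell rung on the node `EACDensityQuestion` (Mantova–Masser's density question for surfaces
`W ⊆ ℂ² × (ℂˣ)²` of case (dim-pi-S-1-free), *Further remarks* §1 p. 5 — "unclear, even for
`n = 2`").  `EACDensityNonFree` decided the typed question for surfaces with multiplicatively
DEPENDENT torus part over a LINE base (always dense).  This file does the same over a GRAPH base
`x₁ = P(x₀)`, `deg P ≥ 2`, and here the answer is a genuine dichotomy: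

**Theorem** (`unprojectedDense_of_not_isMulFree_graph`, `exists_eq_graphPolySurface_C_of_rel`,
`unprojectedDense_iff_of_not_isMulFree_graph`).  Let `W` be an irreducible surface meeting the
torus, with base inside the graph `x₁ = P(x₀)` (`deg P ≥ 2`) and a non-trivial monomial
`y₀^{m₀} y₁^{m₁}` constant on `W ∩ G²`.
* If `m₁ ≠ 0`, the exponential points of `W` are Zariski dense in `W`.
* If `m₁ = 0`, then `W = {x₁ = P(x₀), y₀ = η}` for some `η ≠ 0`, the constant-fibre family of
  `EACDensityPhases`, where density holds iff some phase of `P` at `log η` is irrational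
  (`unprojectedDense_const_iff`); e.g. the resonant parabola is NOT dense.

So Mantova–Masser's question AS TYPED is decided for every dependent surface over a graph base,
and together with `EACDensityNonFree` for every dependent surface over a line or a graph.

## Mechanism (new on this node for the first bullet)

Write the relation as `(y₀^p y₁^q)^g = c` with `(p, q)` primitive, `q < 0` (signs normalised),
complete to `U = (p q; -v u) ∈ SL₂(ℤ)` (Bezout).  The transform `W^U` lies in the finite union of
the sheets `Σ_η = {(U·(t, P(t)), η, s)}` (`η^g = c`), each the image of the constant-fibre surface
`{x₁ = P(x₀), y₀ = η}` under the ADDITIVE-linear change `(x, y) ↦ (U x, y)` (`addLin`, realised on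
polynomials by `addLinSubst`, so the sheets are irreducible closed surfaces by the substitution
lemmas of `EACDensityTransport`); prime avoidance and dimension rigidity (`EACDensityNonFree`) give
`W^U = Σ_η`.  The exponential points of `Σ_η` are `(R(t), Q(t), η, e^{Q(t)})` with `R = p X + q P`,
`Q = -v X + u P`, over the roots `t` of `e^{R(t)} = η`; the Bezout identity `u R - q Q = X` turns
the relation into `e^{-q Q(t)} = e^{t} · e^{-u R(t)} = e^{t} · η^{-u}` on these points, so along the
left-half-plane root sequence of `EACDensityAligned` (`exists_alignedSeq` with constant
`q̂ = η`: roots of `e^{R(t)} = η` with `e^{t}` decaying super-polynomially against `‖t‖`) the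
free coordinate
`s = e^{Q(t)}` decays super-polynomially (`q < 0`), and the Liouville elimination of
`EACDensityQuestion` (`eq_zero_of_eval₂_eq_zero_of_superdecay`) forces every polynomial vanishing
on the exponential points to vanish on `Σ_η`.  Density transports back to `W`
(`unprojectedDense_latticeClosure_iff`).

HONEST FRAMING.  A modest rung of Zilber's exponential-algebraic-closedness programme on an
explicitly typed open question; the analysis is entirely the cell's earlier root supply and
elimination, the new input is the bookkeeping that makes them meet (the Bezout identity).  The
free question, dependent surfaces over bases that are neither lines nor graphs, `ECCell 3 2` and
everything about Schanuel's conjecture remain OPEN (EAC ⇏ SC).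
-/

noncomputable section

open Filter Topology MvPolynomial Matrix Complex

namespace Literature.ModelTheory.Zilber

open Literature.NumberTheory.Transcendental Literature.ModelTheory.ExponentialFields

/-! ## Part 1 — the additive-linear coordinate change `(x, y) ↦ (U x, y)` -/

section AddLin

variable {K : Type*} [Field K] {n : ℕ}

/-- The additive-linear coordinate change `(x, y) ↦ (U x, y)` of an integer matrix `U`.
[folklore] -/
def addLin (U : Matrix (Fin n) (Fin n) ℤ) (z : Fin n ⊕ Fin n → K) : Fin n ⊕ Fin n → K :=
  Sum.elim (intLinMap U (projAdd z)) (projMul z)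

/-- Additive coordinates of `addLin U z`. [folklore] -/
@[simp] theorem addLin_inl (U : Matrix (Fin n) (Fin n) ℤ) (z : Fin n ⊕ Fin n → K) (i : Fin n) :
    addLin U z (Sum.inl i) = intLinMap U (projAdd z) i := rfl

/-- Multiplicative coordinates of `addLin U z` are unchanged. [folklore] -/
@[simp] theorem addLin_inr (U : Matrix (Fin n) (Fin n) ℤ) (z : Fin n ⊕ Fin n → K) (i : Fin n) :
    addLin U z (Sum.inr i) = z (Sum.inr i) := rfl

/-- `π(addLin U z) = U π(z)`. [folklore] -/
theorem projAdd_addLin (U : Matrix (Fin n) (Fin n) ℤ) (z : Fin n ⊕ Fin n → K) :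
    projAdd (addLin U z) = intLinMap U (projAdd z) := rfl

/-- For an inverse pair the changes are mutually inverse. [folklore] -/
theorem addLin_addLin_of_mul_eq_one {U V : Matrix (Fin n) (Fin n) ℤ} (hVU : V * U = 1)
    (z : Fin n ⊕ Fin n → K) : addLin V (addLin U z) = z := by
  funext i
  rcases i with i | i
  · rw [addLin_inl, projAdd_addLin, intLinMap_intLinMap_of_mul_eq_one hVU, projAdd_apply]
  · rfl

/-- The substitution `xᵢ ↦ ∑ⱼ U i j xⱼ`, `yᵢ ↦ yᵢ` realising `addLin U` on polynomials.
[folklore] -/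
def addLinSubst (U : Matrix (Fin n) (Fin n) ℤ) :
    MvPolynomial (Fin n ⊕ Fin n) K →ₐ[K] MvPolynomial (Fin n ⊕ Fin n) K :=
  aeval (Sum.elim (fun i => ∑ j, C ((U i j : ℤ) : K) * X (Sum.inl j))
    fun i => (X (Sum.inr i) : MvPolynomial (Fin n ⊕ Fin n) K))

/-- `addLinSubst U xᵢ = ∑ⱼ U i j xⱼ`. [folklore] -/
theorem addLinSubst_X_inl (U : Matrix (Fin n) (Fin n) ℤ) (i : Fin n) :
    addLinSubst U (X (Sum.inl i) : MvPolynomial (Fin n ⊕ Fin n) K) =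
      ∑ j, C ((U i j : ℤ) : K) * X (Sum.inl j) := by
  rw [addLinSubst, aeval_X]; rfl

/-- `addLinSubst U yᵢ = yᵢ`. [folklore] -/
theorem addLinSubst_X_inr (U : Matrix (Fin n) (Fin n) ℤ) (i : Fin n) :
    addLinSubst U (X (Sum.inr i) : MvPolynomial (Fin n ⊕ Fin n) K) = X (Sum.inr i) := by
  rw [addLinSubst, aeval_X]; rfl

/-- **Evaluation rule**: `f(addLin U z) = (addLinSubst U f)(z)`. [folklore] -/
theorem aeval_addLinSubst (U : Matrix (Fin n) (Fin n) ℤ) (z : Fin n ⊕ Fin n → K)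
    (f : MvPolynomial (Fin n ⊕ Fin n) K) : aeval z (addLinSubst U f) = aeval (addLin U z) f := by
  have h1 : (aeval z).comp (addLinSubst (K := K) U) = aeval (addLin U z) := by
    rw [addLinSubst, comp_aeval]
    congr 1
    funext v
    rcases v with i | i
    · simp only [Sum.elim_inl, map_sum, map_mul, aeval_C, aeval_X, addLin_inl, intLinMap,
        projAdd_apply, Algebra.algebraMap_self_apply]
    · simp only [Sum.elim_inr, aeval_X, addLin_inr]
  have h2 := DFunLike.congr_fun h1 f
  rw [AlgHom.comp_apply] at h2
  exact h2

/-- Functoriality (contravariant): `addLinSubst U ∘ addLinSubst V = addLinSubst (V U)`.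
[folklore] -/
theorem addLinSubst_comp (U V : Matrix (Fin n) (Fin n) ℤ) :
    (addLinSubst (K := K) U).comp (addLinSubst V) = addLinSubst (V * U) := by
  refine algHom_ext fun w => ?_
  rcases w with i | i
  · rw [AlgHom.comp_apply, addLinSubst_X_inl, addLinSubst_X_inl, map_sum]
    simp only [map_mul, algHom_C, MvPolynomial.algebraMap_eq, addLinSubst_X_inl, Matrix.mul_apply,
      Int.cast_sum, Int.cast_mul, map_sum, Finset.mul_sum, Finset.sum_mul]
    rw [Finset.sum_comm]
    exact Finset.sum_congr rfl fun k _ => Finset.sum_congr rfl fun j _ => by ring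
  · rw [AlgHom.comp_apply, addLinSubst_X_inr, addLinSubst_X_inr, addLinSubst_X_inr]

/-- `addLinSubst 1 = id`. [folklore] -/
theorem addLinSubst_one :
    addLinSubst (K := K) (1 : Matrix (Fin n) (Fin n) ℤ) = AlgHom.id K _ := by
  classical
  refine algHom_ext fun w => ?_
  rcases w with i | i
  · rw [addLinSubst_X_inl, AlgHom.id_apply]
    simp only [Matrix.one_apply]
    rw [Finset.sum_eq_single i (fun j _ hj => by
        rw [if_neg (Ne.symm hj), Int.cast_zero, C_0, zero_mul])
      (fun h => absurd (Finset.mem_univ i) h), if_pos rfl, Int.cast_one, C_1, one_mul]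
  · rw [addLinSubst_X_inr, AlgHom.id_apply]

/-- For an inverse pair the substitution is an algebra automorphism. [folklore] -/
def addLinSubstEquiv {U V : Matrix (Fin n) (Fin n) ℤ} (hUV : U * V = 1) (hVU : V * U = 1) :
    MvPolynomial (Fin n ⊕ Fin n) K ≃ₐ[K] MvPolynomial (Fin n ⊕ Fin n) K :=
  AlgEquiv.ofAlgHom (addLinSubst U) (addLinSubst V) (by rw [addLinSubst_comp, hVU, addLinSubst_one])
    (by rw [addLinSubst_comp, hUV, addLinSubst_one])

/-- Images of irreducible closed sets under `addLin U` (`U ∈ GL_n(ℤ)`) are irreducible closed.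
[folklore] -/
theorem isIrreducibleClosed_image_addLin {U V : Matrix (Fin n) (Fin n) ℤ} (hUV : U * V = 1)
    (hVU : V * U = 1) {S : Set (Fin n ⊕ Fin n → K)} (hS : IsIrreducibleClosed K S) :
    IsIrreducibleClosed K (addLin U '' S) :=
  isIrreducibleClosed_image_of_subst (φ := addLin U) (ψ := addLin V) (e := addLinSubst U)
    (e' := addLinSubst V) (aeval_addLinSubst U) (aeval_addLinSubst V)
    (addLin_addLin_of_mul_eq_one hUV) (addLin_addLin_of_mul_eq_one hVU) hS

/-- … and have the same dimension. [folklore] -/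
theorem zariskiDim_image_addLin {U V : Matrix (Fin n) (Fin n) ℤ} (hUV : U * V = 1)
    (hVU : V * U = 1) (S : Set (Fin n ⊕ Fin n → K)) :
    zariskiDim K (addLin U '' S) = zariskiDim K S :=
  zariskiDim_image_of_subst (addLinSubstEquiv hUV hVU) (fun z f => aeval_addLinSubst U z f) S

end AddLin

/-! ## Part 2 — the sheets `Σ_η = addLin U ({x₁ = P(x₀), y₀ = η})` and their exponential points -/

section Sheets

variable (U : Matrix (Fin 2) (Fin 2) ℤ) (P : Polynomial ℂ) (ρ : ℂ)

/-- The rows of `U` applied to the graph: `lgRow U P i = U i 0 · X + U i 1 · P`. [folklore] -/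
def lgRow (i : Fin 2) : Polynomial ℂ :=
  Polynomial.C ((U i 0 : ℤ) : ℂ) * Polynomial.X + Polynomial.C ((U i 1 : ℤ) : ℂ) * P

/-- Evaluation of `lgRow`. [folklore] -/
@[simp] theorem eval_lgRow (i : Fin 2) (t : ℂ) :
    (lgRow U P i).eval t = (U i 0 : ℂ) * t + (U i 1 : ℂ) * P.eval t := by
  simp [lgRow]

/-- `U·(t, P(t)) = (lgRow U P 0 (t), lgRow U P 1 (t))`. [folklore] -/
theorem intLinMap_graphPt (t : ℂ) (i : Fin 2) :
    intLinMap U ![t, P.eval t] i = (lgRow U P i).eval t := by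
  simp [intLinMap_apply_two]

/-- The sheet `Σ_ρ = addLin U ({x₁ = P(x₀), y₀ = ρ}) = {(U·(t, P(t)), ρ, s)}`. [folklore] -/
def linGraphSurface : Set (Fin 2 ⊕ Fin 2 → ℂ) :=
  addLin U '' graphPolySurface P (Polynomial.C ρ)

/-- The parametrisation `(t, s) ↦ (lgRow U P 0 (t), lgRow U P 1 (t), ρ, s)`. [folklore] -/
def lgParam (t s : ℂ) : Fin 2 ⊕ Fin 2 → ℂ :=
  Sum.elim ![(lgRow U P 0).eval t, (lgRow U P 1).eval t] ![ρ, s]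

/-- Coordinate `x₀`. [folklore] -/
@[simp] theorem lgParam_inl_zero (t s : ℂ) :
    lgParam U P ρ t s (Sum.inl 0) = (lgRow U P 0).eval t := rfl
/-- Coordinate `x₁`. [folklore] -/
@[simp] theorem lgParam_inl_one (t s : ℂ) :
    lgParam U P ρ t s (Sum.inl 1) = (lgRow U P 1).eval t := rfl
/-- Coordinate `y₀`. [folklore] -/
@[simp] theorem lgParam_inr_zero (t s : ℂ) : lgParam U P ρ t s (Sum.inr 0) = ρ := rfl
/-- Coordinate `y₁`. [folklore] -/
@[simp] theorem lgParam_inr_one (t s : ℂ) : lgParam U P ρ t s (Sum.inr 1) = s := rfl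

/-- `addLin U (t, P(t), ρ, s) = lgParam U P ρ t s`. [folklore] -/
theorem addLin_gpParam (t s : ℂ) :
    addLin U (gpParam P (Polynomial.C ρ) t s) = lgParam U P ρ t s := by
  funext i
  rcases i with i | i <;> fin_cases i
  · simp [intLinMap_apply_two, projAdd_apply]
  · simp [intLinMap_apply_two, projAdd_apply]
  · simp
  · simp

/-- `lgParam U P ρ t s ∈ Σ_ρ`. [folklore] -/
theorem lgParam_mem (t s : ℂ) : lgParam U P ρ t s ∈ linGraphSurface U P ρ :=
  ⟨_, gpParam_mem P (Polynomial.C ρ) t s, addLin_gpParam U P ρ t s⟩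

/-- Every point of `Σ_ρ` is an `lgParam`. [folklore] -/
theorem exists_eq_lgParam {z : Fin 2 ⊕ Fin 2 → ℂ} (hz : z ∈ linGraphSurface U P ρ) :
    ∃ t s : ℂ, z = lgParam U P ρ t s := by
  obtain ⟨w, hw, rfl⟩ := hz
  refine ⟨w (Sum.inl 0), w (Sum.inr 1), ?_⟩
  rw [← addLin_gpParam]
  congr 1
  exact eq_gpParam_of_mem P _ hw

/-- The exponential points of `Σ_ρ`: `lgParam U P ρ t s` with `e^{R(t)} = ρ`, `e^{Q(t)} = s`.
[folklore] -/
theorem lgParam_mem_expGraph {t s : ℂ} (h0 : exp ((lgRow U P 0).eval t) = ρ)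
    (h1 : exp ((lgRow U P 1).eval t) = s) : lgParam U P ρ t s ∈ expGraph ℂ 2 := by
  rw [mem_expGraph_iff]
  intro i
  fin_cases i
  · simpa [ExponentialRing.complex_exp_eq] using h0.symm
  · simpa [ExponentialRing.complex_exp_eq] using h1.symm

/-- The symbolic parametrisation in `ℂ[t][s]`: `x₀ ↦ R(t)`, `x₁ ↦ Q(t)`, `y₀ ↦ ρ`, `y₁ ↦ s`.
[folklore] -/
def lgSymb : Fin 2 ⊕ Fin 2 → Polynomial (Polynomial ℂ) :=
  Sum.elim ![Polynomial.C (lgRow U P 0), Polynomial.C (lgRow U P 1)]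
    ![Polynomial.C (Polynomial.C ρ), Polynomial.X]

/-- Pull-back of `F ∈ ℂ[x₀, x₁, y₀, y₁]` to `ℂ[t][s]` along `lgSymb`. [folklore] -/
def lgPullback (F : MvPolynomial (Fin 2 ⊕ Fin 2) ℂ) : Polynomial (Polynomial ℂ) :=
  eval₂Hom (Polynomial.C.comp Polynomial.C) (lgSymb U P ρ) F

/-- `mmEval t s` on the symbols gives the coordinates of `lgParam U P ρ t s`. [folklore] -/
theorem mmEval_lgSymb (t s : ℂ) : (fun i => mmEval t s (lgSymb U P ρ i)) = lgParam U P ρ t s := by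
  funext i
  rcases i with i | i <;> fin_cases i <;> simp [lgSymb, lgParam]

/-- **The pull-back evaluates to `F` on the parametrised point.** [folklore] -/
theorem mmEval_lgPullback (F : MvPolynomial (Fin 2 ⊕ Fin 2) ℂ) (t s : ℂ) :
    mmEval t s (lgPullback U P ρ F) = MvPolynomial.eval (lgParam U P ρ t s) F := by
  rw [lgPullback, ← RingHom.comp_apply, MvPolynomial.comp_eval₂Hom, mmEval_comp_C, mmEval_lgSymb]
  rfl

/-- **Abstract density criterion for `Σ_ρ` (Liouville elimination).** Exponential points
`lgParam U P ρ (t_k) (s_k)` with `‖t_k‖ → ∞`, `s_k ≠ 0` and `‖s_k‖ ‖t_k‖^N → 0` for every `N` force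
`I(Σ_ρ ∩ Γ_exp) = I(Σ_ρ)`. [folklore] -/
theorem unprojectedDense_linGraphSurface_of_seq (t s : ℕ → ℂ)
    (ht : Tendsto (fun k => ‖t k‖) atTop atTop) (hs : ∀ k, s k ≠ 0)
    (hdec : ∀ N : ℕ, Tendsto (fun k => ‖s k‖ * ‖t k‖ ^ N) atTop (𝓝 0))
    (hexp₀ : ∀ k, exp ((lgRow U P 0).eval (t k)) = ρ)
    (hexp₁ : ∀ k, exp ((lgRow U P 1).eval (t k)) = s k) :
    UnprojectedDense (linGraphSurface U P ρ) := by
  refine le_antisymm ?_ (vanishingIdeal_anti_mono Set.inter_subset_left)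
  intro F hF
  have hG0 : lgPullback U P ρ F = 0 := by
    refine eq_zero_of_eval₂_eq_zero_of_superdecay (lgPullback U P ρ F) t s ht hs hdec fun k => ?_
    rw [← mmEval_eq_eval₂, mmEval_lgPullback, ← coe_aeval_eq_eval]
    exact (mem_vanishingIdeal_iff.mp hF) _
      ⟨lgParam_mem U P ρ _ _, lgParam_mem_expGraph U P ρ (hexp₀ k) (hexp₁ k)⟩
  rw [mem_vanishingIdeal_iff]
  intro z hz
  obtain ⟨t₀, s₀, rfl⟩ := exists_eq_lgParam U P ρ hz
  have h := mmEval_lgPullback U P ρ F t₀ s₀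
  rw [hG0, map_zero] at h
  simpa [coe_aeval_eq_eval] using h.symm

end Sheets

/-! ## Part 3 — the Bezout identity and the decaying sequence of exponential points on `Σ_ρ` -/

section Seq

variable {p q u v : ℤ} (P : Polynomial ℂ)

/-- **The Bezout identity on the rows**: `u · R(t) - q · Q(t) = t` for `U = (p q; -v u)`,
`p u + q v = 1`. [folklore] -/
theorem eval_lgRow_bezout (h : p * u + q * v = 1) (t : ℂ) :
    (u : ℂ) * (lgRow (bezoutMat p q u v) P 0).eval t -
      (q : ℂ) * (lgRow (bezoutMat p q u v) P 1).eval t = t := by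
  have hC : (p : ℂ) * u + q * v = 1 := by exact_mod_cast h
  have h00 : bezoutMat p q u v 0 0 = p := by simp [bezoutMat]
  have h01 : bezoutMat p q u v 0 1 = q := by simp [bezoutMat]
  have h10 : bezoutMat p q u v 1 0 = -v := by simp [bezoutMat]
  have h11 : bezoutMat p q u v 1 1 = u := by simp [bezoutMat]
  rw [eval_lgRow, eval_lgRow, h00, h01, h10, h11]
  push_cast
  linear_combination t * hC

/-- `deg R = deg P` when `q ≠ 0` and `deg P ≥ 2` (`R = p X + q P`). [folklore] -/
theorem natDegree_lgRow_bezout_zero (hq : q ≠ 0) (hd : 2 ≤ P.natDegree) :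
    (lgRow (bezoutMat p q u v) P 0).natDegree = P.natDegree := by
  have h00 : bezoutMat p q u v 0 0 = p := by simp [bezoutMat]
  have h01 : bezoutMat p q u v 0 1 = q := by simp [bezoutMat]
  rw [lgRow, h00, h01]
  have hqC : ((q : ℤ) : ℂ) ≠ 0 := Int.cast_ne_zero.2 hq
  have h2 : (Polynomial.C ((q : ℤ) : ℂ) * P).natDegree = P.natDegree :=
    Polynomial.natDegree_C_mul hqC
  have h1 : (Polynomial.C ((p : ℤ) : ℂ) * Polynomial.X).natDegree ≤ 1 :=
    Polynomial.natDegree_mul_le.trans (by simp)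
  rw [Polynomial.natDegree_add_eq_right_of_natDegree_lt (by rw [h2]; omega), h2]

/-- **The decaying sequence.** For `U = (p q; -v u)` with `p u + q v = 1`, `q < 0`, `deg P ≥ 2`
and `ρ ≠ 0` there are exponential points `lgParam U P ρ (t_k) (e^{Q(t_k)})` of `Σ_ρ`
(`e^{R(t_k)} = ρ`) with `‖t_k‖ → ∞` and `s_k = e^{Q(t_k)}` decaying super-polynomially: take the
left-half-plane root sequence of `e^{R(t)} = ρ` from `EACDensityAligned.exists_alignedSeq` (there
`e^{t_k}` decays super-polynomially) and use `(e^{Q(t_k)})^{-q} = e^{t_k} · e^{-u R(t_k)} =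
e^{t_k} · η` with `|η| = |e^{-u log ρ}|` constant (Bezout identity; `R(t_k) ∈ log ρ + 2πiℤ`).
[folklore] -/
theorem exists_linGraphSeq (h : p * u + q * v = 1) (hq : q < 0) (hd : 2 ≤ P.natDegree) {ρ : ℂ}
    (hρ : ρ ≠ 0) :
    ∃ t s : ℕ → ℂ, Tendsto (fun k => ‖t k‖) atTop atTop ∧ (∀ k, s k ≠ 0) ∧
      (∀ N : ℕ, Tendsto (fun k => ‖s k‖ * ‖t k‖ ^ N) atTop (𝓝 0)) ∧
      (∀ k, exp ((lgRow (bezoutMat p q u v) P 0).eval (t k)) = ρ) ∧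
      ∀ k, exp ((lgRow (bezoutMat p q u v) P 1).eval (t k)) = s k := by
  set R := lgRow (bezoutMat p q u v) P 0 with hR
  set Q := lgRow (bezoutMat p q u v) P 1 with hQ
  have hdR : 2 ≤ R.natDegree := by
    rw [hR, natDegree_lgRow_bezout_zero P hq.ne hd]; exact hd
  have hR0 : R ≠ 0 := Polynomial.ne_zero_of_natDegree_gt (show 0 < R.natDegree by omega)
  obtain ⟨ω, σ, hσ, hω, hre⟩ :=
    exists_rootDirection R.leadingCoeff (Polynomial.leadingCoeff_ne_zero.2 hR0) R.natDegree hdR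
  have hq0' : (Polynomial.C ρ).eval 0 ≠ 0 := by simpa using hρ
  obtain ⟨t, w, ht, hw, hdec, hexp₁, hexp₂⟩ :=
    exists_alignedSeq R (Polynomial.C ρ) hdR hq0' ω σ hσ hω hre
  have hexpR : ∀ k, exp (R.eval (t k)) = ρ := fun k => by simpa using hexp₂ k
  -- `q' = -q > 0`
  set q' : ℕ := (-q).toNat with hq'
  have hq'pos : 0 < q' := by omega
  have hq'C : ((q' : ℕ) : ℂ) = -(q : ℂ) := by
    have h1 : ((q' : ℕ) : ℤ) = -q := by omega
    exact_mod_cast h1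
  set c₀ : ℂ := Complex.log ρ with hc₀
  have hec₀ : exp c₀ = ρ := Complex.exp_log hρ
  -- the key identity `‖e^{Q(t_k)}‖^{q'} = ‖w_k‖ · ‖e^{-u c₀}‖`
  have key : ∀ k, ‖exp (Q.eval (t k))‖ ^ q' = ‖w k‖ * ‖exp (-(u : ℂ) * c₀)‖ := by
    intro k
    obtain ⟨j, hj⟩ : ∃ j : ℤ, R.eval (t k) = c₀ + j * (2 * Real.pi * I) :=
      Complex.exp_eq_exp_iff_exists_int.1 ((hexpR k).trans hec₀.symm)
    rw [← norm_pow, ← Complex.exp_nat_mul, hq'C, ← hexp₁ k, ← norm_mul, ← Complex.exp_add]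
    have hrel := eval_lgRow_bezout P h (t k)
    rw [← hR, ← hQ] at hrel
    have h3 : -(q : ℂ) * Q.eval (t k) =
        (t k + -(u : ℂ) * c₀) + ((-u * j : ℤ) : ℂ) * (2 * Real.pi * I) := by
      push_cast
      linear_combination hrel - (u : ℂ) * hj
    rw [h3, Complex.exp_add _ (((-u * j : ℤ) : ℂ) * _), Complex.exp_int_mul_two_pi_mul_I, mul_one]
  refine ⟨t, fun k => exp (Q.eval (t k)), ht, fun k => Complex.exp_ne_zero _, fun N => ?_, hexpR,
    fun k => rfl⟩
  set C₀ : ℝ := ‖exp (-(u : ℂ) * c₀)‖ with hC₀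
  have hlim : Tendsto (fun k => (‖exp (Q.eval (t k))‖ * ‖t k‖ ^ N) ^ q') atTop (𝓝 0) := by
    have h1 : ∀ k, (‖exp (Q.eval (t k))‖ * ‖t k‖ ^ N) ^ q' = C₀ * (‖w k‖ * ‖t k‖ ^ (N * q')) := by
      intro k
      rw [mul_pow, key k, ← pow_mul]
      ring
    simp_rw [h1]
    simpa using (hdec (N * q')).const_mul C₀
  have hq'inv : (0 : ℝ) ≤ (q' : ℝ)⁻¹ := by positivity
  have h2 := hlim.rpow_const (Or.inr hq'inv)
  rw [Real.zero_rpow (inv_ne_zero (Nat.cast_ne_zero.2 hq'pos.ne'))] at h2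
  refine h2.congr fun k => ?_
  exact Real.pow_rpow_inv_natCast (by positivity) hq'pos.ne'

/-- **Density of the sheets**: for `U = (p q; -v u)`, `p u + q v = 1`, `q < 0`, `deg P ≥ 2` and
`ρ ≠ 0` the exponential points of `Σ_ρ` are Zariski dense in it. [folklore] -/
theorem unprojectedDense_linGraphSurface (h : p * u + q * v = 1) (hq : q < 0)
    (hd : 2 ≤ P.natDegree) {ρ : ℂ} (hρ : ρ ≠ 0) :
    UnprojectedDense (linGraphSurface (bezoutMat p q u v) P ρ) := by
  obtain ⟨t, s, ht, hs, hdec, he₀, he₁⟩ := exists_linGraphSeq P h hq hd hρ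
  exact unprojectedDense_linGraphSurface_of_seq _ P ρ t s ht hs hdec he₀ he₁

end Seq

/-! ## Part 4 — normalising the multiplicative relation -/

section Relation

variable {W : Set (Fin 2 ⊕ Fin 2 → ℂ)}

/-- A relation `y₀^{m₀} y₁^{m₁} = c` with `m₁ ≠ 0` in primitive form `(y₀^p y₁^q)^g = c'` with
`(p, q)` completed by Bezout, `g > 0`, `c' ≠ 0` and the sign normalised to `q < 0`. [folklore] -/
theorem exists_primitive_relation (hne : (W ∩ torusLocus ℂ 2).Nonempty) {m : Fin 2 → ℤ}
    (hm1 : m 1 ≠ 0) {c : ℂ} (hc : ∀ z ∈ W ∩ torusLocus ℂ 2, ∏ i, z (Sum.inr i) ^ m i = c) :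
    ∃ (p q u v : ℤ) (g : ℕ) (c' : ℂ), p * u + q * v = 1 ∧ 0 < g ∧ c' ≠ 0 ∧ q < 0 ∧
      ∀ z ∈ W ∩ torusLocus ℂ 2, (z (Sum.inr 0) ^ p * z (Sum.inr 1) ^ q) ^ g = c' := by
  have hc0 : c ≠ 0 := ne_zero_of_mul_relation hne hc
  have hgpos : 0 < Int.gcd (m 0) (m 1) := Int.gcd_pos_iff.2 (Or.inr hm1)
  obtain ⟨g, p, q, hg, hpq, hp, hq⟩ := Int.exists_gcd_one' hgpos
  have huv : p * Int.gcdA p q + q * Int.gcdB p q = 1 := by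
    have h := Int.gcd_eq_gcd_ab p q
    rw [hpq, Nat.cast_one] at h
    exact h.symm
  have hrel : ∀ z ∈ W ∩ torusLocus ℂ 2, (z (Sum.inr 0) ^ p * z (Sum.inr 1) ^ q) ^ g = c := by
    intro z hz
    rw [← hc z hz, Fin.prod_univ_two, hp, hq, mul_pow, ← zpow_natCast, ← zpow_natCast,
      ← _root_.zpow_mul, ← _root_.zpow_mul]
  have hq0 : q ≠ 0 := by
    rintro rfl
    rw [zero_mul] at hq
    exact hm1 hq
  rcases lt_or_gt_of_ne hq0 with hqneg | hqpos
  · exact ⟨p, q, Int.gcdA p q, Int.gcdB p q, g, c, huv, hg, hc0, hqneg, hrel⟩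
  · refine ⟨-p, -q, -Int.gcdA p q, -Int.gcdB p q, g, c⁻¹, by linear_combination huv, hg,
      inv_ne_zero hc0, by omega, fun z hz => ?_⟩
    rw [← hrel z hz, _root_.zpow_neg, _root_.zpow_neg, ← mul_inv, inv_pow]

/-- A relation `y₀^{m₀} y₁^{m₁} = c` with `m₁ = 0`, `m ≠ 0`, in the form `y₀^g = c'`, `g > 0`,
`c' ≠ 0`. [folklore] -/
theorem exists_pow_relation (hne : (W ∩ torusLocus ℂ 2).Nonempty) {m : Fin 2 → ℤ} (hm : m ≠ 0)
    (hm1 : m 1 = 0) {c : ℂ} (hc : ∀ z ∈ W ∩ torusLocus ℂ 2, ∏ i, z (Sum.inr i) ^ m i = c) :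
    ∃ (g : ℕ) (c' : ℂ), 0 < g ∧ c' ≠ 0 ∧ ∀ z ∈ W ∩ torusLocus ℂ 2, z (Sum.inr 0) ^ g = c' := by
  have hc0 : c ≠ 0 := ne_zero_of_mul_relation hne hc
  have hm0 : m 0 ≠ 0 := by
    intro h0
    apply hm
    funext i
    fin_cases i
    · exact h0
    · exact hm1
  have hrel : ∀ z ∈ W ∩ torusLocus ℂ 2, z (Sum.inr 0) ^ m 0 = c := by
    intro z hz
    rw [← hc z hz, Fin.prod_univ_two, hm1, zpow_zero, mul_one]
  rcases lt_or_gt_of_ne hm0 with hneg | hpos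
  · refine ⟨(-m 0).toNat, c⁻¹, by omega, inv_ne_zero hc0, fun z hz => ?_⟩
    have h1 : (((-m 0).toNat : ℕ) : ℤ) = -m 0 := by omega
    rw [← hrel z hz, ← zpow_natCast, h1, _root_.zpow_neg]
  · refine ⟨(m 0).toNat, c, by omega, hc0, fun z hz => ?_⟩
    have h1 : (((m 0).toNat : ℕ) : ℤ) = m 0 := by omega
    rw [← hrel z hz, ← zpow_natCast, h1]

end Relation

/-! ## Part 5 — structure: `W^U` is a sheet; for `m₁ = 0`, `W` is a constant-fibre surface -/

section Structure

variable {W : Set (Fin 2 ⊕ Fin 2 → ℂ)} {P : Polynomial ℂ}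

/-- **Structure theorem (transported form).** Let `W` be irreducible closed of dimension `2`,
meeting the torus, with base in the graph `x₁ = P(x₀)` and relation `(y₀^p y₁^q)^g = c`
(`p u + q v = 1`, `g > 0`, `c ≠ 0`).  Then `W^U = Σ_η` for `U = (p q; -v u)` and some `η` with
`η^g = c`: `Φ_U(W ∩ G²)` lies in the finite union of the sheets `Σ_η` (closed, irreducible,
`2`-dimensional), prime avoidance puts `W^U` in one of them, rigidity gives equality.
[folklore] -/
theorem exists_latticeClosure_eq_linGraphSurface (hW : IsIrreducibleClosed ℂ W)
    (hne : (W ∩ torusLocus ℂ 2).Nonempty) (hdim : zariskiDim ℂ W = (2 : ℕ))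
    (hP : ∀ z ∈ W ∩ torusLocus ℂ 2, z (Sum.inl 1) = P.eval (z (Sum.inl 0)))
    {p q u v : ℤ} (h : p * u + q * v = 1) {g : ℕ} (hg : 0 < g) {c : ℂ} (hc0 : c ≠ 0)
    (hrel : ∀ z ∈ W ∩ torusLocus ℂ 2, (z (Sum.inr 0) ^ p * z (Sum.inr 1) ^ q) ^ g = c) :
    ∃ η : ℂ, η ≠ 0 ∧ η ^ g = c ∧
      latticeClosure (bezoutMat p q u v) W = linGraphSurface (bezoutMat p q u v) P η := by
  classical
  set U := bezoutMat p q u v with hUdef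
  set V := bezoutInv p q u v with hVdef
  have hUV : U * V = 1 := bezoutMat_mul_bezoutInv h
  have hVU : V * U = 1 := bezoutInv_mul_bezoutMat h
  -- `Φ_U(W ∩ G²)` lies in the union of the sheets
  have himg : latticeImage U W ⊆ ⋃ η ∈ Polynomial.nthRootsFinset g c, linGraphSurface U P η := by
    rintro _ ⟨z, hz, rfl⟩
    set η : ℂ := z (Sum.inr 0) ^ p * z (Sum.inr 1) ^ q with hη
    refine Set.mem_biUnion ((Polynomial.mem_nthRootsFinset hg c).2 (hrel z hz)) ?_
    have hpt :
        latticeChange U z = lgParam U P η (z (Sum.inl 0)) (latticeChange U z (Sum.inr 1)) := by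
      have hx : projAdd z = ![z (Sum.inl 0), P.eval (z (Sum.inl 0))] := by
        funext j
        fin_cases j
        · simp [projAdd_apply]
        · simpa [projAdd_apply] using hP z hz
      funext i
      rcases i with i | i <;> fin_cases i
      · simp [hx, intLinMap_graphPt]
      · simp [hx, intLinMap_graphPt]
      · simpa [hUdef] using latticeChange_bezoutMat_inr_zero p q u v z
      · simp
    rw [hpt]
    exact lgParam_mem U P η _ _
  -- prime avoidance: `W^U` lies in one sheet
  obtain ⟨η, hη, hsub⟩ := exists_subset_of_dense_subset_biUnion
    (isIrreducibleClosed_latticeClosure U hW hne).2 (vanishingIdeal_latticeClosure U W).symm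
    (Polynomial.nthRootsFinset g c) (fun η => linGraphSurface U P η)
    (fun η _ => (isIrreducibleClosed_image_addLin hUV hVU
      (isIrreducibleClosed_graphPolySurface P (Polynomial.C η))).1) himg
  have hηg : η ^ g = c := (Polynomial.mem_nthRootsFinset hg c).1 hη
  have hη0 : η ≠ 0 := by
    rintro rfl
    rw [zero_pow hg.ne'] at hηg
    exact hc0 hηg.symm
  refine ⟨η, hη0, hηg, ?_⟩
  -- rigidity: same dimension
  refine eq_of_subset_of_zariskiDim_eq (isZariskiClosed_latticeClosure U W)
    (isIrreducibleClosed_image_addLin hUV hVU (isIrreducibleClosed_graphPolySurface P _)) hsub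
    ((zariskiDim_latticeClosure hUV hVU hW hne).trans hdim) ?_
  rw [linGraphSurface, zariskiDim_image_addLin hUV hVU]
  exact zariskiDim_graphPolySurface P _

/-- **Structure theorem for `m₁ = 0`.** An irreducible closed surface meeting the torus, with
base in the graph `x₁ = P(x₀)` and `y₀^g` constant (`= c ≠ 0`, `g > 0`) on its torus part, IS
the constant-fibre surface `{x₁ = P(x₀), y₀ = η}` for some `η` with `η^g = c` (no coordinate
change needed: the sheets are the surfaces `graphPolySurface P (C η)`). [folklore] -/
theorem exists_eq_graphPolySurface_C_of_pow (hW : IsIrreducibleClosed ℂ W)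
    (hne : (W ∩ torusLocus ℂ 2).Nonempty) (hdim : zariskiDim ℂ W = (2 : ℕ))
    (hP : ∀ z ∈ W ∩ torusLocus ℂ 2, z (Sum.inl 1) = P.eval (z (Sum.inl 0)))
    {g : ℕ} (hg : 0 < g) {c : ℂ} (hc0 : c ≠ 0)
    (hrel : ∀ z ∈ W ∩ torusLocus ℂ 2, z (Sum.inr 0) ^ g = c) :
    ∃ η : ℂ, η ≠ 0 ∧ η ^ g = c ∧ W = graphPolySurface P (Polynomial.C η) := by
  classical
  have himg : W ∩ torusLocus ℂ 2 ⊆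
      ⋃ η ∈ Polynomial.nthRootsFinset g c, graphPolySurface P (Polynomial.C η) := by
    intro z hz
    refine Set.mem_biUnion ((Polynomial.mem_nthRootsFinset hg c).2 (hrel z hz)) ?_
    rw [mem_graphPolySurface_iff, Polynomial.eval_C]
    exact ⟨hP z hz, rfl⟩
  obtain ⟨η, hη, hsub⟩ := exists_subset_of_dense_subset_biUnion hW.2
    (vanishingIdeal_inter_torusLocus_of_irred hW hne) (Polynomial.nthRootsFinset g c)
    (fun η => graphPolySurface P (Polynomial.C η))
    (fun η _ => (isIrreducibleClosed_graphPolySurface P (Polynomial.C η)).1) himg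
  have hηg : η ^ g = c := (Polynomial.mem_nthRootsFinset hg c).1 hη
  have hη0 : η ≠ 0 := by
    rintro rfl
    rw [zero_pow hg.ne'] at hηg
    exact hc0 hηg.symm
  exact ⟨η, hη0, hηg, eq_of_subset_of_zariskiDim_eq hW.1 (isIrreducibleClosed_graphPolySurface P _)
    hsub hdim (zariskiDim_graphPolySurface P _)⟩

end Structure

/-! ## Part 6 — the theorems -/

section Main

variable {W : Set (Fin 2 ⊕ Fin 2 → ℂ)} {P : Polynomial ℂ}

/-- **Density from a primitive relation with `q < 0`** (irreducible closed `2`-dimensional `W`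
meeting the torus, base in the graph of `P`, `deg P ≥ 2`): `W^U = Σ_η` is dense
(`unprojectedDense_linGraphSurface`) and density transports back. [folklore] -/
theorem unprojectedDense_of_relation_graph (hW : IsIrreducibleClosed ℂ W)
    (hne : (W ∩ torusLocus ℂ 2).Nonempty) (hdim : zariskiDim ℂ W = (2 : ℕ))
    (hP : ∀ z ∈ W ∩ torusLocus ℂ 2, z (Sum.inl 1) = P.eval (z (Sum.inl 0)))
    (hd : 2 ≤ P.natDegree) {p q u v : ℤ} (h : p * u + q * v = 1) (hq : q < 0) {g : ℕ}
    (hg : 0 < g) {c : ℂ} (hc0 : c ≠ 0)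
    (hrel : ∀ z ∈ W ∩ torusLocus ℂ 2, (z (Sum.inr 0) ^ p * z (Sum.inr 1) ^ q) ^ g = c) :
    UnprojectedDense W := by
  obtain ⟨η, hη0, -, heq⟩ := exists_latticeClosure_eq_linGraphSurface hW hne hdim hP h hg hc0 hrel
  have hdense : UnprojectedDense (latticeClosure (bezoutMat p q u v) W) := by
    rw [heq]
    exact unprojectedDense_linGraphSurface P h hq hd hη0
  exact (unprojectedDense_latticeClosure_iff (bezoutMat_mul_bezoutInv h)
    (bezoutInv_mul_bezoutMat h) hW hne).1 hdense

/-- **Theorem A — a relation involving `y₁` forces density.** Let `W` be irreducible closed of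
dimension `2`, meeting the torus, with base in the graph `x₁ = P(x₀)` (`deg P ≥ 2`), and let a
monomial `y₀^{m₀} y₁^{m₁}` with `m₁ ≠ 0` be constant on `W ∩ G²`.  Then the exponential points of
`W` are Zariski dense in `W`. [folklore] -/
theorem unprojectedDense_of_not_isMulFree_graph (hW : IsIrreducibleClosed ℂ W)
    (hne : (W ∩ torusLocus ℂ 2).Nonempty) (hdim : zariskiDim ℂ W = (2 : ℕ))
    (hP : ∀ z ∈ W ∩ torusLocus ℂ 2, z (Sum.inl 1) = P.eval (z (Sum.inl 0)))
    (hd : 2 ≤ P.natDegree) {m : Fin 2 → ℤ} (hm1 : m 1 ≠ 0) {c : ℂ}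
    (hc : ∀ z ∈ W ∩ torusLocus ℂ 2, ∏ i, z (Sum.inr i) ^ m i = c) : UnprojectedDense W := by
  obtain ⟨p, q, u, v, g, c', h, hg, hc0, hq, hrel⟩ := exists_primitive_relation hne hm1 hc
  exact unprojectedDense_of_relation_graph hW hne hdim hP hd h hq hg hc0 hrel

/-- **Theorem B — a relation in `y₀` alone identifies `W`.** Under the same hypotheses with
`m₁ = 0` (`m ≠ 0`), `W = {x₁ = P(x₀), y₀ = η}` for some `η ≠ 0` — the constant-fibre family of
`EACDensityPhases`, decided there by the phase criterion `unprojectedDense_const_iff` (and NOT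
always dense: the resonant parabola). [folklore] -/
theorem exists_eq_graphPolySurface_C_of_rel (hW : IsIrreducibleClosed ℂ W)
    (hne : (W ∩ torusLocus ℂ 2).Nonempty) (hdim : zariskiDim ℂ W = (2 : ℕ))
    (hP : ∀ z ∈ W ∩ torusLocus ℂ 2, z (Sum.inl 1) = P.eval (z (Sum.inl 0)))
    {m : Fin 2 → ℤ} (hm : m ≠ 0) (hm1 : m 1 = 0) {c : ℂ}
    (hc : ∀ z ∈ W ∩ torusLocus ℂ 2, ∏ i, z (Sum.inr i) ^ m i = c) :
    ∃ η : ℂ, η ≠ 0 ∧ W = graphPolySurface P (Polynomial.C η) := by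
  obtain ⟨g, c', hg, hc0, hrel⟩ := exists_pow_relation hne hm hm1 hc
  obtain ⟨η, hη0, -, heq⟩ := exists_eq_graphPolySurface_C_of_pow hW hne hdim hP hg hc0 hrel
  exact ⟨η, hη0, heq⟩

/-- **The dichotomy for dependent surfaces over a graph base** (in particular for every `W` of
case (dim-pi-S-1-free) with such a base): dense, or a constant-fibre surface
`{x₁ = P(x₀), y₀ = η}`. [folklore] -/
theorem unprojectedDense_or_eq_const_of_not_isMulFree_graph (hW : IsIrreducibleClosed ℂ W)
    (hne : (W ∩ torusLocus ℂ 2).Nonempty) (hdim : zariskiDim ℂ W = (2 : ℕ))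
    (hP : ∀ z ∈ W ∩ torusLocus ℂ 2, z (Sum.inl 1) = P.eval (z (Sum.inl 0)))
    (hd : 2 ≤ P.natDegree) (hdep : ¬ IsMulFree ℂ 2 (W ∩ torusLocus ℂ 2)) :
    UnprojectedDense W ∨ ∃ η : ℂ, η ≠ 0 ∧ W = graphPolySurface P (Polynomial.C η) := by
  unfold IsMulFree at hdep
  push Not at hdep
  obtain ⟨m, hm0, c, hc⟩ := hdep
  by_cases hm1 : m 1 = 0
  · exact Or.inr (exists_eq_graphPolySurface_C_of_rel hW hne hdim hP hm0 hm1 hc)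
  · exact Or.inl (unprojectedDense_of_not_isMulFree_graph hW hne hdim hP hd hm1 hc)

/-- **Complete decision of Mantova–Masser's typed question for dependent surfaces over a graph
base.** Such a `W` has Zariski dense exponential points iff it is not a constant-fibre surface
`{x₁ = P(x₀), y₀ = η}` all of whose phases at `log η` are rational (the phase criterion of
`EACDensityPhases`). [folklore] -/
theorem unprojectedDense_iff_of_not_isMulFree_graph (hW : IsIrreducibleClosed ℂ W)
    (hne : (W ∩ torusLocus ℂ 2).Nonempty) (hdim : zariskiDim ℂ W = (2 : ℕ))
    (hP : ∀ z ∈ W ∩ torusLocus ℂ 2, z (Sum.inl 1) = P.eval (z (Sum.inl 0)))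
    (hd : 2 ≤ P.natDegree) (hdep : ¬ IsMulFree ℂ 2 (W ∩ torusLocus ℂ 2)) :
    UnprojectedDense W ↔ ∀ η : ℂ, η ≠ 0 → W = graphPolySurface P (Polynomial.C η) →
      ¬ ∀ j, 0 < j → ∃ r : ℚ,
        (phasePoly P (Complex.log η)).coeff j = (r : ℂ) * (2 * Real.pi * I) := by
  constructor
  · intro hD η hη heq
    rw [heq] at hD
    exact (unprojectedDense_const_iff (Complex.exp_log hη)).1 hD
  · intro H
    rcases unprojectedDense_or_eq_const_of_not_isMulFree_graph hW hne hdim hP hd hdep with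
      hD | ⟨η, hη, heq⟩
    · exact hD
    · rw [heq]
      exact (unprojectedDense_const_iff (Complex.exp_log hη)).2 (H η hη heq)

/-- **Instances of the typed question**: every `W` of case (dim-pi-S-1-free) over a graph base
`x₁ = P(x₀)` (`deg P ≥ 2`) with a relation involving `y₁` is a positive instance
(case ∧ dense). [folklore] -/
theorem unprojectedDensityQuestion_instance_dependent_graph (hW : MMCaseDimPiOneFree W)
    (hP : ∀ z ∈ W ∩ torusLocus ℂ 2, z (Sum.inl 1) = P.eval (z (Sum.inl 0)))
    (hd : 2 ≤ P.natDegree) {m : Fin 2 → ℤ} (hm1 : m 1 ≠ 0) {c : ℂ}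
    (hc : ∀ z ∈ W ∩ torusLocus ℂ 2, ∏ i, z (Sum.inr i) ^ m i = c) :
    MMCaseDimPiOneFree W ∧ UnprojectedDense W :=
  ⟨hW, unprojectedDense_of_not_isMulFree_graph hW.1 hW.2.1 hW.2.2.1 hP hd hm1 hc⟩

end Main

/-! ## Part 7 — the sheets are in the case: explicit new positive instances -/

section Instances

variable {K : Type*} [Field K] {n : ℕ}

/-- `addLin U` preserves the torus part. [folklore] -/
theorem image_addLin_inter_torusLocus (U : Matrix (Fin n) (Fin n) ℤ)
    (S : Set (Fin n ⊕ Fin n → K)) :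
    addLin U '' S ∩ torusLocus K n = addLin U '' (S ∩ torusLocus K n) := by
  ext z
  constructor
  · rintro ⟨⟨w, hw, rfl⟩, hz⟩
    exact ⟨w, ⟨hw, by simpa [mem_torusLocus_iff] using hz⟩, rfl⟩
  · rintro ⟨w, ⟨hw, hwt⟩, rfl⟩
    exact ⟨⟨w, hw, rfl⟩, by simpa [mem_torusLocus_iff] using hwt⟩

/-- `π ∘ addLin U = U ∘ π` on images. [folklore] -/
theorem projAdd_image_addLin (U : Matrix (Fin n) (Fin n) ℤ) (T : Set (Fin n ⊕ Fin n → K)) :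
    projAdd '' (addLin U '' T) = intLinMap U '' (projAdd '' T) := by
  rw [Set.image_image, Set.image_image]
  rfl

/-- `addProjDim` is invariant under `addLin U` (inverse pair). [folklore] -/
theorem addProjDim_image_addLin {U V : Matrix (Fin n) (Fin n) ℤ} (hUV : U * V = 1)
    (hVU : V * U = 1) (S : Set (Fin n ⊕ Fin n → K)) :
    addProjDim K n (addLin U '' S) = addProjDim K n S := by
  rw [addProjDim, addProjDim, image_addLin_inter_torusLocus, projAdd_image_addLin,
    zariskiDim_image_intLinMap hUV hVU]

/-- **Case (dim-pi-S-1-free) is invariant under `addLin U`** (`U ∈ GL₂(ℤ)`). [folklore] -/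
theorem mmCaseDimPiOneFree_image_addLin {U V : Matrix (Fin 2) (Fin 2) ℤ} (hUV : U * V = 1)
    (hVU : V * U = 1) {W : Set (Fin 2 ⊕ Fin 2 → ℂ)} (h : MMCaseDimPiOneFree W) :
    MMCaseDimPiOneFree (addLin U '' W) := by
  obtain ⟨hW, hne, hdim, hapd, hline⟩ := h
  refine ⟨isIrreducibleClosed_image_addLin hUV hVU hW, ?_,
    (zariskiDim_image_addLin hUV hVU W).trans hdim, ?_, ?_⟩
  · rw [image_addLin_inter_torusLocus]
    exact hne.image _
  · rw [addProjDim_image_addLin hUV hVU, hapd]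
  · rw [image_addLin_inter_torusLocus, projAdd_image_addLin,
      zeroLocus_vanishingIdeal_image_intLinMap hUV hVU]
    exact fun h' => hline (isRationalSlopeLine_of_image_intLinMap hUV hVU h')

/-- The sheets `Σ_ρ` (`U ∈ GL₂(ℤ)`, `deg P ≥ 2`, `ρ ≠ 0`) are in case (dim-pi-S-1-free).
[folklore] -/
theorem mmCase_linGraphSurface {U V : Matrix (Fin 2) (Fin 2) ℤ} (hUV : U * V = 1)
    (hVU : V * U = 1) {P : Polynomial ℂ} (hd : 2 ≤ P.natDegree) {ρ : ℂ} (hρ : ρ ≠ 0) :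
    MMCaseDimPiOneFree (linGraphSurface U P ρ) :=
  mmCaseDimPiOneFree_image_addLin hUV hVU (mmCase_graphPolySurface_C hd hρ)

/-- … and multiplicatively dependent (`y₀ = ρ` on them). [folklore] -/
theorem not_isMulFree_linGraphSurface (U : Matrix (Fin 2) (Fin 2) ℤ) (P : Polynomial ℂ) (ρ : ℂ) :
    ¬ IsMulFree ℂ 2 (linGraphSurface U P ρ ∩ torusLocus ℂ 2) := by
  intro h
  refine h (Pi.single 0 1) ?_ ⟨ρ, fun z hz => ?_⟩
  · intro h0
    have := congrFun h0 0
    simp at this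
  · obtain ⟨t, s, rfl⟩ := exists_eq_lgParam U P ρ hz.1
    rw [Fin.prod_univ_two]
    simp

/-- **New positive instances of the typed question**: for `U = (p q; -v u)`, `p u + q v = 1`,
`q < 0`, `deg P ≥ 2`, `ρ ≠ 0` the sheet `Σ_ρ` — base the curve `U·{x₁ = P(x₀)}` (not a graph
over either axis when `|q| ≥ 2` and `p ≠ 0`), torus part dependent — is in the case AND dense.
[folklore] -/
theorem linGraphSurface_instance {p q u v : ℤ} (h : p * u + q * v = 1) (hq : q < 0)
    {P : Polynomial ℂ} (hd : 2 ≤ P.natDegree) {ρ : ℂ} (hρ : ρ ≠ 0) :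
    MMCaseDimPiOneFree (linGraphSurface (bezoutMat p q u v) P ρ) ∧
      ¬ IsMulFree ℂ 2 (linGraphSurface (bezoutMat p q u v) P ρ ∩ torusLocus ℂ 2) ∧
      UnprojectedDense (linGraphSurface (bezoutMat p q u v) P ρ) :=
  ⟨mmCase_linGraphSurface (bezoutMat_mul_bezoutInv h) (bezoutInv_mul_bezoutMat h) hd hρ,
    not_isMulFree_linGraphSurface _ P ρ, unprojectedDense_linGraphSurface P h hq hd hρ⟩

/-- **… and all their `GL₂(ℤ)`-transforms**, e.g. `(Σ_ρ)^{U⁻¹}` with torus part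
`{x₁ = P(x₀)} × {y₀^p y₁^q = ρ}`: case ∧ dependent ∧ dense. [folklore] -/
theorem latticeClosure_linGraphSurface_instance {U' V' : Matrix (Fin 2) (Fin 2) ℤ}
    (hU'V' : U' * V' = 1) (hV'U' : V' * U' = 1) {p q u v : ℤ} (h : p * u + q * v = 1)
    (hq : q < 0) {P : Polynomial ℂ} (hd : 2 ≤ P.natDegree) {ρ : ℂ} (hρ : ρ ≠ 0) :
    MMCaseDimPiOneFree (latticeClosure U' (linGraphSurface (bezoutMat p q u v) P ρ)) ∧
      ¬ IsMulFree ℂ 2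
        (latticeClosure U' (linGraphSurface (bezoutMat p q u v) P ρ) ∩ torusLocus ℂ 2) ∧
      UnprojectedDense (latticeClosure U' (linGraphSurface (bezoutMat p q u v) P ρ)) := by
  obtain ⟨hcase, hdep, hdense⟩ := linGraphSurface_instance h hq hd hρ
  refine ⟨mmCaseDimPiOneFree_latticeClosure hU'V' hV'U' hcase, fun hfree => ?_,
    unprojectedDense_latticeClosure hU'V' hV'U' hcase.1.1 hdense⟩
  have h1 := isMulFree_latticeClosure_inter hV'U' hU'V' (isZariskiClosed_latticeClosure U' _) hfree
  rw [latticeClosure_latticeClosure_inter_torusLocus hU'V' hV'U' hcase.1.1] at h1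
  exact hdep h1

end Instances

end Literature.ModelTheory.Zilber

end
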